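import Mathlib
import Summits.NavierStokesRegularity.Statement
import Literature.Analysis.FluidPDE.ClassicalSolution
import Literature.Analysis.FluidPDE.LerayHopf
import Literature.Analysis.FluidPDE.SuitableWeak
import Literature.Analysis.FluidPDE.LocalTypeI
import Literature.Analysis.FluidPDE.CKN1982Setting
import Literature.Analysis.FluidPDE.ClassicalSuitable
import Literature.Analysis.FluidPDE.NSViscosityRescaling
import Literature.Analysis.FluidPDE.NSLerayHopfABCScaling
import Literature.Analysis.FluidPDE.PressureDecayEstimate
import Literature.Analysis.FluidPDE.PressureDecayEstimateProofs
import Literature.Analysis.FluidPDE.ClassicalTopPointCubic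
import Literature.Analysis.FluidPDE.BesovBlowupConcentration
import Literature.Analysis.FluidPDE.LerayHopfSpatialGradient
import Literature.Analysis.FluidPDE.NSSuitableESSProofs
import Literature.Analysis.FluidPDE.Seregin2020ScaledEnergyBounds
import Summits.NavierStokesRegularity.NavierStokesRegularity.Theses.RootDecompLitSlice
import Summits.NavierStokesRegularity.NavierStokesRegularity.Theses.RootDecompMorreyBudget
import Summits.NavierStokesRegularity.NavierStokesRegularity.Theses.EulerZoomLiouville
import Summits.NavierStokesRegularity.NavierStokesRegularity.Theses.RootDecompStaticSkirt
import Summits.NavierStokesRegularity.NavierStokesRegularity.Theorems.EulerZoomLiouvilleSereginZoomReduction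
import Summits.NavierStokesRegularity.NavierStokesRegularity.Theorems.QuarterJoltNoTerminalJoltPosition
import Summits.NavierStokesRegularity.NavierStokesRegularity.Theorems.RootDecompStaticSkirtEngineKillsConicalJolt
import Summits.NavierStokesRegularity.NavierStokesRegularity.Theorems.RootDecompStaticSkirtJoltingCells

/-!
# N25 «THE STATIC SKIRT» · ONSAGER EDGE SEAM KERNEL — GX 33328 ⟸ CC ∧ NA ∧ QL and LJᶜ 33319 ⟸ X_E ∧ CC ∧ NA ∧ QL

Lens-6 g15/g16 kernels K6 (pressure gauge from the cubic gauge: iteration of the PROVED Seregin–Šverák decay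
estimate), K7 (apex suitability of the viscosity-normalised classical Leray–Hopf solution, tree-assembled) and K8
(the flux gauge GX from the two clocks), composed with the LANDED engine kill 33329
(`Theorems.RootDecompStaticSkirtEngineKill.rootDecompStaticSkirt_engineKillsConicalJolt_proof`) — critic row 163
booking (3): «bank the K-kernels as Theorems over the born decls».  The three Onsager-edge hypotheses are written as
the VERBATIM ledger signatures of the child route `RootDecompOnsagerEdge` items CC / NA / QL (so the seam item
`OnsagerSeam := X_E → CC → NA → QL → NoTameConicalJoltingSkirt` closes from `noTameConicalJoltingSkirt_of_onsager` by
`fun hXE hCC hNA hQL => …` definitionally); the conclusions are N25's TREE decls `ConicalSkirtFluxGauge` (support 33328)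
and `NoTameConicalJoltingSkirt` (LJᶜ 33319).  X_E = `EulerZoomLiouville.PowerGaugeEulerLiouville` (stmt-19832) BY NAME.

Sources: CKN 1982 §2; Lin 1998; Seregin–Šverák pressure decay (tree `seregin_sverak_pressure_decay_holds`);
Seregin 2026 (1.7)/(3.1); lens file HOME/decomp-ns-lens-6/OnsagerEdge.lean K6/K7/K8 (sha256 of record on the bus).
-/

noncomputable section

set_option linter.dupNamespace false

namespace Summit.NavierStokesRegularity.NavierStokesRegularity.Theorems.RootDecompStaticSkirtOnsagerSeam

open Summit.NavierStokesRegularity.NavierStokesRegularity.Theses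
open scoped Topology ENNReal NNReal InnerProductSpace RealInnerProductSpace
open Filter Set MeasureTheory Metric Function
open Literature.Analysis.FluidPDE

/-! ## K6 · the pressure gauge from the cubic gauge -/

/-- **K6 · PRESSURE GAUGE FROM CUBIC GAUGE.** For a distributional NS solution (ν = 1) in `Q_{r₁}(z)` with `D(r₁) < ∞`:
if `r^{γ} C(r) ≤ M_C` on `(0, r₁]` for some `γ ∈ (0, 1]`, then `r^{γ} D(r) ≤ M_D` on `(0, r₁]`. Proof: the tree's PROVED
decay `D(θr) ≤ c(θ D(r) + θ⁻² C(r))` (`seregin_sverak_pressure_decay_holds.ratio`) with `θ = min(1/2, 1/(2(c+1)))` is a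
contraction for `F(r) = r^{γ}D(r)` (`cθ^{γ+1} ≤ cθ ≤ 1/2`) along `θ^j r₁`, and one more decay step interpolates to every
`s ∈ (0, r₁]`. [CKN 1982 §2 / Lin 1998 / Seregin–Šverák pressure decay; elementary iteration] -/
theorem pressureGauge_of_cubicGauge
    {v : ℝ → EuclideanSpace ℝ (Fin 3) → EuclideanSpace ℝ (Fin 3)} {q : ℝ → EuclideanSpace ℝ (Fin 3) → ℝ}
    {z : ℝ × EuclideanSpace ℝ (Fin 3)} {r₁ γ : ℝ} (hr₁ : 0 < r₁) (hγ : 0 < γ) (_hγ1 : γ ≤ 1)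
    (hsol : IsDistributionalNSSolutionOn (parabolicCylinderOpens r₁ z) 1 0 v q)
    (hD : cknD r₁ z q ≠ ∞)
    {MC : ℝ≥0} (hC : ∀ r ∈ Set.Ioc 0 r₁, ENNReal.ofReal (r ^ γ) * cknC r z v ≤ MC) :
    ∃ MD : ℝ≥0, ∀ r ∈ Set.Ioc 0 r₁, ENNReal.ofReal (r ^ γ) * cknD r z q ≤ MD := by
  obtain ⟨c, hc⟩ := seregin_sverak_pressure_decay_holds.ratio
  have hc0 : (0 : ℝ) ≤ c := c.coe_nonneg
  -- the ratio `θ`, with `c θ ≤ 1/2`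
  set θ : ℝ := min (1 / 2) (1 / (2 * ((c : ℝ) + 1))) with hθdef
  have hθpos : 0 < θ := by rw [hθdef]; positivity
  have hθhalf : θ ≤ 1 / 2 := min_le_left _ _
  have hθ1 : θ ≤ 1 := hθhalf.trans (by norm_num)
  have hθlt1 : θ < 1 := lt_of_le_of_lt hθhalf (by norm_num)
  have hcθ : (c : ℝ) * θ ≤ 1 / 2 := by
    have h := min_le_right (1 / 2 : ℝ) (1 / (2 * ((c : ℝ) + 1)))
    rw [← hθdef] at h
    calc (c : ℝ) * θ ≤ (c : ℝ) * (1 / (2 * ((c : ℝ) + 1))) := mul_le_mul_of_nonneg_left h hc0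
      _ = (c : ℝ) / ((c : ℝ) + 1) * (1 / 2) := by field_simp
      _ ≤ 1 * (1 / 2) := by
          refine mul_le_mul_of_nonneg_right ?_ (by norm_num)
          rw [div_le_one (by positivity)]; linarith
      _ = 1 / 2 := one_mul _
  -- cylinders below `r₁` lie in the region
  have hsub : ∀ r ∈ Set.Ioc 0 r₁,
      parabolicCylinder r z ⊆ (parabolicCylinderOpens r₁ z : Set (ℝ × EuclideanSpace ℝ (Fin 3))) := by
    intro r hr; rw [coe_parabolicCylinderOpens]; exact parabolicCylinder_mono hr.1.le hr.2 z
  -- the gauged pressure quantity and the source bound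
  set F : ℝ → ℝ≥0∞ := fun r => ENNReal.ofReal (r ^ γ) * cknD r z q with hFdef
  set B : ℝ≥0∞ := (c : ℝ≥0∞) * ENNReal.ofReal ((θ⁻¹) ^ 2) * (MC : ℝ≥0∞) with hBdef
  have hBtop : B ≠ ∞ := by
    rw [hBdef]; exact ENNReal.mul_ne_top (ENNReal.mul_ne_top ENNReal.coe_ne_top ENNReal.ofReal_ne_top)
      ENNReal.coe_ne_top
  -- ONE STEP at ratio `t ∈ [θ, 1]`: `F(t r) ≤ c t^{γ+1} F(r) + B`
  have hstep : ∀ r ∈ Set.Ioc 0 r₁, ∀ t : ℝ, θ ≤ t → t ≤ 1 →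
      F (t * r) ≤ (c : ℝ≥0∞) * ENNReal.ofReal (t ^ (γ + 1)) * F r + B := by
    intro r hr t hθt ht1
    have htpos : 0 < t := lt_of_lt_of_le hθpos hθt
    have hdec := hc (parabolicCylinderOpens r₁ z) v q hsol z r t hr.1 htpos ht1 (hsub r hr)
    have hsplit : (t * r) ^ γ = t ^ γ * r ^ γ := Real.mul_rpow htpos.le hr.1.le
    have htg : 0 ≤ t ^ γ := Real.rpow_nonneg htpos.le γ
    have hrg : 0 ≤ r ^ γ := Real.rpow_nonneg hr.1.le γ
    have e1 : F (t * r) = ENNReal.ofReal (t ^ γ) * (ENNReal.ofReal (r ^ γ) * cknD (t * r) z q) := by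
      simp only [hFdef]; rw [hsplit, ENNReal.ofReal_mul htg, mul_assoc]
    rw [e1]
    calc ENNReal.ofReal (t ^ γ) * (ENNReal.ofReal (r ^ γ) * cknD (t * r) z q)
        ≤ ENNReal.ofReal (t ^ γ) * (ENNReal.ofReal (r ^ γ) *
            ((c : ℝ≥0∞) * (ENNReal.ofReal t * cknD r z q + ENNReal.ofReal ((t⁻¹) ^ 2) * cknC r z v))) := by
          gcongr
      _ = (c : ℝ≥0∞) * (ENNReal.ofReal (t ^ γ) * ENNReal.ofReal t) * (ENNReal.ofReal (r ^ γ) * cknD r z q) +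
          (c : ℝ≥0∞) * (ENNReal.ofReal (t ^ γ) * ENNReal.ofReal ((t⁻¹) ^ 2)) *
            (ENNReal.ofReal (r ^ γ) * cknC r z v) := by ring
      _ ≤ (c : ℝ≥0∞) * ENNReal.ofReal (t ^ (γ + 1)) * F r + B := by
          have h1 : ENNReal.ofReal (t ^ γ) * ENNReal.ofReal t = ENNReal.ofReal (t ^ (γ + 1)) := by
            rw [← ENNReal.ofReal_mul htg, Real.rpow_add_one htpos.ne' γ]
          have h2 : ENNReal.ofReal (t ^ γ) * ENNReal.ofReal ((t⁻¹) ^ 2) ≤ ENNReal.ofReal ((θ⁻¹) ^ 2) := by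
            have ha : ENNReal.ofReal (t ^ γ) ≤ 1 := by
              rw [← ENNReal.ofReal_one]; exact ENNReal.ofReal_le_ofReal (Real.rpow_le_one htpos.le ht1 hγ.le)
            have hb : ENNReal.ofReal ((t⁻¹) ^ 2) ≤ ENNReal.ofReal ((θ⁻¹) ^ 2) := by
              refine ENNReal.ofReal_le_ofReal ?_
              have : t⁻¹ ≤ θ⁻¹ := inv_anti₀ hθpos hθt
              have ht0 : 0 ≤ t⁻¹ := inv_nonneg.2 htpos.le
              nlinarith
            calc ENNReal.ofReal (t ^ γ) * ENNReal.ofReal ((t⁻¹) ^ 2) ≤ 1 * ENNReal.ofReal ((θ⁻¹) ^ 2) :=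
                  mul_le_mul' ha hb
              _ = ENNReal.ofReal ((θ⁻¹) ^ 2) := one_mul _
          have h3 : ENNReal.ofReal (r ^ γ) * cknC r z v ≤ MC := hC r hr
          rw [h1, hBdef]
          simp only [hFdef]
          gcongr
  -- the dyadic iteration `F(θʲ r₁) ≤ F(r₁) + 2B`
  have hθj : ∀ j : ℕ, θ ^ j * r₁ ∈ Set.Ioc 0 r₁ := fun j =>
    ⟨mul_pos (pow_pos hθpos j) hr₁, mul_le_of_le_one_left hr₁.le (pow_le_one₀ hθpos.le hθ1)⟩
  have hα : (c : ℝ≥0∞) * ENNReal.ofReal (θ ^ (γ + 1)) ≤ 2⁻¹ := by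
    have h1 : θ ^ (γ + 1) ≤ θ := by
      have := Real.rpow_le_rpow_of_exponent_ge hθpos hθ1 (show (1 : ℝ) ≤ γ + 1 by linarith)
      rwa [Real.rpow_one] at this
    calc (c : ℝ≥0∞) * ENNReal.ofReal (θ ^ (γ + 1)) ≤ (c : ℝ≥0∞) * ENNReal.ofReal θ := by
          gcongr
      _ = ENNReal.ofReal ((c : ℝ) * θ) := by
          rw [ENNReal.ofReal_mul hc0, ENNReal.ofReal_coe_nnreal]
      _ ≤ ENNReal.ofReal (1 / 2) := ENNReal.ofReal_le_ofReal hcθ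
      _ = 2⁻¹ := by rw [one_div, ENNReal.ofReal_inv_of_pos two_pos, ENNReal.ofReal_ofNat]
  have hiter : ∀ j : ℕ, F (θ ^ j * r₁) ≤ F r₁ + 2 * B := by
    intro j
    induction j with
    | zero => simp
    | succ j ih =>
        have h := hstep (θ ^ j * r₁) (hθj j) θ le_rfl hθ1
        rw [← mul_assoc, ← pow_succ'] at h
        calc F (θ ^ (j + 1) * r₁) ≤ (c : ℝ≥0∞) * ENNReal.ofReal (θ ^ (γ + 1)) * F (θ ^ j * r₁) + B := h
          _ ≤ 2⁻¹ * (F r₁ + 2 * B) + B := by gcongr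
          _ = 2⁻¹ * F r₁ + (B + B) := by
              have h2 : (2 : ℝ≥0∞)⁻¹ * (2 * B) = B := by
                rw [← mul_assoc, ENNReal.inv_mul_cancel (by norm_num) (by norm_num), one_mul]
              rw [mul_add, h2, add_assoc]
          _ ≤ 1 * F r₁ + (B + B) := by gcongr; norm_num
          _ = F r₁ + 2 * B := by rw [one_mul, two_mul]
  -- every scale `s ≤ r₁` sits at ratio `t ∈ (θ, 1]` below some `θʲ r₁`
  have hall : ∀ s ∈ Set.Ioc 0 r₁, F s ≤ (c : ℝ≥0∞) * (F r₁ + 2 * B) + B := by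
    intro s hs
    have hx : 0 < s / r₁ := div_pos hs.1 hr₁
    have hx1 : s / r₁ ≤ 1 := (div_le_one hr₁).2 hs.2
    obtain ⟨n, hn1, hn2⟩ := exists_nat_pow_near_of_lt_one hx hx1 hθpos hθlt1
    have hθn : 0 < θ ^ n := pow_pos hθpos n
    set t : ℝ := s / r₁ / θ ^ n with htdef
    have ht1 : t ≤ 1 := by rw [htdef, div_le_one hθn]; exact hn2
    have hθt : θ ≤ t := by
      rw [htdef, le_div_iff₀ hθn]
      have : θ * θ ^ n = θ ^ (n + 1) := by ring
      rw [this]; exact hn1.le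
    have hts : t * (θ ^ n * r₁) = s := by
      rw [htdef]; field_simp
    have h := hstep (θ ^ n * r₁) (hθj n) t hθt ht1
    rw [hts] at h
    have htpos : 0 < t := lt_of_lt_of_le hθpos hθt
    calc F s ≤ (c : ℝ≥0∞) * ENNReal.ofReal (t ^ (γ + 1)) * F (θ ^ n * r₁) + B := h
      _ ≤ (c : ℝ≥0∞) * 1 * (F r₁ + 2 * B) + B := by
          gcongr
          · rw [← ENNReal.ofReal_one]
            exact ENNReal.ofReal_le_ofReal (Real.rpow_le_one htpos.le ht1 (by linarith))
          · exact hiter n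
      _ = (c : ℝ≥0∞) * (F r₁ + 2 * B) + B := by rw [mul_one]
  -- finiteness of the bound
  have hF₁ : F r₁ ≠ ∞ := by
    simp only [hFdef]; exact ENNReal.mul_ne_top ENNReal.ofReal_ne_top hD
  have htop : (c : ℝ≥0∞) * (F r₁ + 2 * B) + B ≠ ∞ := by
    refine ENNReal.add_ne_top.2 ⟨ENNReal.mul_ne_top ENNReal.coe_ne_top ?_, hBtop⟩
    exact ENNReal.add_ne_top.2 ⟨hF₁, ENNReal.mul_ne_top (by norm_num) hBtop⟩
  refine ⟨((c : ℝ≥0∞) * (F r₁ + 2 * B) + B).toNNReal, fun s hs => ?_⟩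
  rw [ENNReal.coe_toNNReal htop]
  exact hall s hs

/-! ## K7 · apex suitability of the normalised classical Leray–Hopf solution -/

/-- **K7 · APEX SUITABILITY.** For a classical solution on `[0,T)` with viscosity `ν` in the Leray–Hopf class, the
normalised pair `(v, q) = (ν⁻¹u(·/ν), gauged ν⁻²p(·/ν))` is a suitable weak solution in every parabolic ball
`Q_{r'}(νT, x₀)` with `r'² ≤ νT` on which the classical gradient of `v` is square integrable, and that classical
gradient is a weak spatial gradient there (tree: `isSuitableWeakSolutionInBall_apex_of_classical`, viscosity rescalings
`IsClassicalNSSolutionOn.viscosityRescale_set`, `IsLerayHopfOn.viscosityRescale`, `hasWeakSpatialGradientOn_of_contDiffOn`). -/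
theorem apex_suitable {ν T : ℝ} (hν : 0 < ν) (hT : 0 < T)
    {u : ℝ → EuclideanSpace ℝ (Fin 3) → EuclideanSpace ℝ (Fin 3)} {p : ℝ → EuclideanSpace ℝ (Fin 3) → ℝ}
    (hcl : IsClassicalNSSolutionOn (Set.Ico 0 T) ν 0 u p) (hLH : IsLerayHopfOn T ν 0 (u 0) u)
    (x₀ : EuclideanSpace ℝ (Fin 3)) {r' : ℝ} (_hr' : 0 < r') (hr'T : r' ^ 2 ≤ ν * T)
    (hE : ∫⁻ w in parabolicCylinder r' (ν * T, x₀),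
      ENNReal.ofReal (frobeniusNormSq (fderiv ℝ ((fun s y => ν⁻¹ • u (s / ν) y) w.1) w.2)) < ∞) :
    IsSuitableWeakSolutionInBall r' (ν * T, x₀) (fun s y => ν⁻¹ • u (s / ν) y)
        (fun s y => (timeRescale ν⁻¹ (ν⁻¹ ^ 2) p) s y -
          ((timeRescale ν⁻¹ (ν⁻¹ ^ 2) p) s 0 - normalisedPressure (timeRescale ν⁻¹ ν⁻¹ u s) 0)) ∧
      HasWeakSpatialGradientOn (parabolicCylinderOpens r' (ν * T, x₀)) (fun s y => ν⁻¹ • u (s / ν) y)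
        (fun s y => fderiv ℝ ((fun s y => ν⁻¹ • u (s / ν) y) s) y) := by
  have hν0 : ν ≠ 0 := hν.ne'
  have hνi : 0 < ν⁻¹ := inv_pos.2 hν
  have hνT : 0 < ν * T := mul_pos hν hT
  set v : ℝ → EuclideanSpace ℝ (Fin 3) → EuclideanSpace ℝ (Fin 3) := timeRescale ν⁻¹ ν⁻¹ u with hv
  set π : ℝ → EuclideanSpace ℝ (Fin 3) → ℝ := timeRescale ν⁻¹ (ν⁻¹ ^ 2) p with hπ
  have hvN : (fun s y => ν⁻¹ • u (s / ν) y) = v := by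
    funext s y; simp [hv, div_eq_inv_mul]
  have hslice : ∀ s, v s = ν⁻¹ • u (ν⁻¹ * s) := fun s => rfl
  have hmaps : MapsTo (fun s => ν⁻¹ * s) (Ico 0 (ν * T)) (Ico 0 T) := by
    intro s hs'
    refine ⟨mul_nonneg hνi.le hs'.1, ?_⟩
    calc ν⁻¹ * s < ν⁻¹ * (ν * T) := mul_lt_mul_of_pos_left hs'.2 hνi
      _ = T := by rw [← mul_assoc, inv_mul_cancel₀ hν0, one_mul]
  have hs' : IsClassicalNSSolutionOn (Ico 0 (ν * T)) 1 0 v π := by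
    have := hcl.viscosityRescale_set hν0 hmaps (uniqueDiffOn_Ico 0 (ν * T))
    rwa [timeRescale_zero_force] at this
  have hv0 : v 0 = ν⁻¹ • u 0 := by rw [hslice, mul_zero]
  have hLH' : IsLerayHopfOn (ν * T) 1 0 (v 0) v := by
    have := hLH.viscosityRescale hνi
    rw [div_inv_eq_mul, mul_comm T ν, inv_mul_cancel₀ hν0, timeRescale_zero_force] at this
    rwa [hv0]
  rw [hvN] at hE ⊢
  have hIn := isSuitableWeakSolutionInBall_apex_of_classical hνT hs' hLH' hr'T hE
  refine ⟨hIn, ?_⟩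
  set Q : TopologicalSpace.Opens (ℝ × EuclideanSpace ℝ (Fin 3)) :=
    ⟨Ioo 0 (ν * T) ×ˢ univ, isOpen_Ioo.prod isOpen_univ⟩ with hQdef
  have hQ : (Q : Set (ℝ × EuclideanSpace ℝ (Fin 3))) ⊆ Ioo 0 (ν * T) ×ˢ univ := Subset.rfl
  have hsm : IsSmoothSpaceTimeOn (Ioo 0 (ν * T)) v := hs'.smooth_velocity.mono Ioo_subset_Ico_self
  have hG : HasWeakSpatialGradientOn Q v fun t x => fderiv ℝ (v t) x :=
    hasWeakSpatialGradientOn_of_contDiffOn isOpen_Ioo hQ (hsm.of_le (by exact_mod_cast le_top))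
  have hIsub : Ioo (ν * T - r' ^ 2) (ν * T) ⊆ Ioo 0 (ν * T) := Ioo_subset_Ioo (by linarith) le_rfl
  have hle : parabolicCylinderOpens r' (ν * T, x₀) ≤ Q := by
    intro w hw
    have hw' : w ∈ parabolicCylinder r' (ν * T, x₀) := hw
    rw [mem_parabolicCylinder] at hw'
    exact ⟨hIsub hw'.1, mem_univ _⟩
  exact hG.mono hle

/-! ## K8 · the flux gauge from the Onsager-edge pieces -/

/-- **K8 · GX 33328 `ConicalSkirtFluxGauge` ⟸ CC ∧ NA ∧ QL** (kernel: K7 apex suitability + K6 pressure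
iteration; the dissipation gauge EE at the vertex is read off NA ∧ QL — the seam K9c).  GX's suitability,
weak-gradient and pressure legs are DISCHARGED against the tree; hypotheses = the ledger signatures of the child
route's items CC `ConicalSkirtCubicGauge`, NA `ConicalSkirtNoAnomaly`, QL `QuietSkirtIsLaminar` VERBATIM. -/
theorem conicalSkirtFluxGauge_of_onsager
    (hCC : ∀ (ν T : ℝ), 0 < ν → 0 < T → ∀ (u : ℝ → EuclideanSpace ℝ (Fin 3) → EuclideanSpace ℝ (Fin 3)) (p : ℝ → EuclideanSpace ℝ (Fin 3) → ℝ), Literature.Analysis.FluidPDE.IsMaximalSmoothSolution ν 0 u p T → Literature.Analysis.FluidPDE.IsLerayHopfOn T ν 0 (u 0) u → Literature.Analysis.FluidPDE.HasRapidSpatialDecay (u 0) → Filter.Tendsto (fun t => MeasureTheory.eLpNorm (u t - u T) 2 MeasureTheory.volume) (nhdsWithin T (Set.Iio T)) (nhds 0) → ∀ (x₀ : EuclideanSpace ℝ (Fin 3)) (r : ℕ → ℝ) (a r₀ C J c η : ℝ), ((∀ k, 0 < r k) ∧ Filter.Tendsto r Filter.atTop (nhds 0) ∧ Filter.Tendsto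 (fun k => (r k)⁻¹ * ∫ x in Metric.ball x₀ (r k), ‖u T x‖ ^ 2) Filter.atTop Filter.atTop) → (∃ c : ℝ, 0 < c ∧ ∀ k, ∃ t ∈ Set.Ioo (T - r k ^ 2) T, c * (∫ x in Metric.ball x₀ (r k), ‖u T x‖ ^ 2) < ∫ x in Metric.ball x₀ (r k), ‖u t x - u T x‖ ^ 2) → 1 < a → a ≤ 3 / 2 → 0 < r₀ → 0 ≤ C → 0 ≤ J → 0 < c → 0 < η → (∀ ρ ∈ Set.Ioc 0 r₀, (∫⁻ x in Metric.ball x₀ ρ, ‖u T x‖ₑ ^ 2 ≤ ENNReal.ofReal (C * ρ ^ (3 - 2 * a))) ∧ ∀ s ∈ Set.Ioo (T - ρ ^ 2 / ν) T, ∫⁻ x in Metric.ball x₀ ρ, ‖u s x - u T x‖ₑ ^ 2 ≤ ENNReal.ofReal J * ∫⁻ x in Metric.ball x₀ ρ, ‖u T x‖ₑ ^ 2) → (∀ k : ℕ, ENNReal.ofReal (c * r k ^ (3 - 2 * a)) ≤ ∫⁻ x in Metric.ball x₀ (r k), ‖u T x‖ₑ ^ 2 ∧ ∀ s ∈ Set.Ioo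 (T - r k ^ (1 + a) / ν) T, ENNReal.ofReal η * ∫⁻ x in Metric.ball x₀ (r k), ‖u T x‖ₑ ^ 2 ≤ ∫⁻ x in Metric.ball x₀ (r k), ‖u s x‖ₑ ^ 2) → ∃ (r₁ : ℝ) (M : NNReal), 0 < r₁ ∧ ∀ r' ∈ Set.Ioc 0 r₁, ENNReal.ofReal (r' ^ (2 * (a - 1))) * Literature.Analysis.FluidPDE.cknC r' (ν * T, x₀) (fun s y => ν⁻¹ • u (s / ν) y) ≤ (M : ENNReal))
    (hNA : ∀ (ν T : ℝ), 0 < ν → 0 < T → ∀ (u : ℝ → EuclideanSpace ℝ (Fin 3) → EuclideanSpace ℝ (Fin 3)) (p : ℝ → EuclideanSpace ℝ (Fin 3) → ℝ), Literature.Analysis.FluidPDE.IsMaximalSmoothSolution ν 0 u p T → Literature.Analysis.FluidPDE.IsLerayHopfOn T ν 0 (u 0) u → Literature.Analysis.FluidPDE.HasRapidSpatialDecay (u 0) → Filter.Tendsto (fun t => MeasureTheory.eLpNorm (u t - u T) 2 MeasureTheory.volume) (nhdsWithin T (Set.Iio T)) (nhds 0) → ∀ (x₀ : EuclideanSpace ℝ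 (Fin 3)) (r : ℕ → ℝ) (a r₀ C J c η : ℝ), ((∀ k, 0 < r k) ∧ Filter.Tendsto r Filter.atTop (nhds 0) ∧ Filter.Tendsto (fun k => (r k)⁻¹ * ∫ x in Metric.ball x₀ (r k), ‖u T x‖ ^ 2) Filter.atTop Filter.atTop) → (∃ c : ℝ, 0 < c ∧ ∀ k, ∃ t ∈ Set.Ioo (T - r k ^ 2) T, c * (∫ x in Metric.ball x₀ (r k), ‖u T x‖ ^ 2) < ∫ x in Metric.ball x₀ (r k), ‖u t x - u T x‖ ^ 2) → 1 < a → a ≤ 3 / 2 → 0 < r₀ → 0 ≤ C → 0 ≤ J → 0 < c → 0 < η → (∀ ρ ∈ Set.Ioc 0 r₀, (∫⁻ x in Metric.ball x₀ ρ, ‖u T x‖ₑ ^ 2 ≤ ENNReal.ofReal (C * ρ ^ (3 - 2 * a))) ∧ ∀ s ∈ Set.Ioo (T - ρ ^ 2 / ν) T, ∫⁻ x in Metric.ball x₀ ρ, ‖u s x - u T x‖ₑ ^ 2 ≤ ENNReal.ofReal J * ∫⁻ x in Metric.ball x₀ ρ, ‖u T x‖ₑ ^ 2) → (∀ k : ℕ,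 ENNReal.ofReal (c * r k ^ (3 - 2 * a)) ≤ ∫⁻ x in Metric.ball x₀ (r k), ‖u T x‖ₑ ^ 2 ∧ ∀ s ∈ Set.Ioo (T - r k ^ (1 + a) / ν) T, ENNReal.ofReal η * ∫⁻ x in Metric.ball x₀ (r k), ‖u T x‖ₑ ^ 2 ≤ ∫⁻ x in Metric.ball x₀ (r k), ‖u s x‖ₑ ^ 2) → Filter.Tendsto (fun r' : ℝ => ENNReal.ofReal (r' ^ (2 * (a - 1))) * Literature.Analysis.FluidPDE.cknE r' (ν * T, x₀) (fun s y => fderiv ℝ (fun y => ν⁻¹ • u (s / ν) y) y)) (nhdsWithin 0 (Set.Ioi 0)) (nhds 0))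
    (hQL : ∀ (ν T : ℝ), 0 < ν → 0 < T → ∀ (u : ℝ → EuclideanSpace ℝ (Fin 3) → EuclideanSpace ℝ (Fin 3)) (p : ℝ → EuclideanSpace ℝ (Fin 3) → ℝ), Literature.Analysis.FluidPDE.IsMaximalSmoothSolution ν 0 u p T → Literature.Analysis.FluidPDE.IsLerayHopfOn T ν 0 (u 0) u → Literature.Analysis.FluidPDE.HasRapidSpatialDecay (u 0) → Filter.Tendsto (fun t => MeasureTheory.eLpNorm (u t - u T) 2 MeasureTheory.volume) (nhdsWithin T (Set.Iio T)) (nhds 0) → ∀ (x₀ : EuclideanSpace ℝ (Fin 3)) (r : ℕ → ℝ) (a r₀ C J c η : ℝ), ((∀ k, 0 < r k) ∧ Filter.Tendsto r Filter.atTop (nhds 0) ∧ Filter.Tendsto (fun k => (r k)⁻¹ * ∫ x in Metric.ball x₀ (r k), ‖u T x‖ ^ 2) Filter.atTop Filter.atTop) → (∃ c : ℝ, 0 < c ∧ ∀ k, ∃ t ∈ Set.Ioo (T - r k ^ 2) T, c * (∫ x in Metric.ball x₀ (r k), ‖u T x‖ ^ 2) < ∫ x in Metric.ball x₀ (r k),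 ‖u t x - u T x‖ ^ 2) → 1 < a → a ≤ 3 / 2 → 0 < r₀ → 0 ≤ C → 0 ≤ J → 0 < c → 0 < η → (∀ ρ ∈ Set.Ioc 0 r₀, (∫⁻ x in Metric.ball x₀ ρ, ‖u T x‖ₑ ^ 2 ≤ ENNReal.ofReal (C * ρ ^ (3 - 2 * a))) ∧ ∀ s ∈ Set.Ioo (T - ρ ^ 2 / ν) T, ∫⁻ x in Metric.ball x₀ ρ, ‖u s x - u T x‖ₑ ^ 2 ≤ ENNReal.ofReal J * ∫⁻ x in Metric.ball x₀ ρ, ‖u T x‖ₑ ^ 2) → (∀ k : ℕ, ENNReal.ofReal (c * r k ^ (3 - 2 * a)) ≤ ∫⁻ x in Metric.ball x₀ (r k), ‖u T x‖ₑ ^ 2 ∧ ∀ s ∈ Set.Ioo (T - r k ^ (1 + a) / ν) T, ENNReal.ofReal η * ∫⁻ x in Metric.ball x₀ (r k), ‖u T x‖ₑ ^ 2 ≤ ∫⁻ x in Metric.ball x₀ (r k), ‖u s x‖ₑ ^ 2) → Filter.Tendsto (fun r' : ℝ => ENNReal.ofReal (r' ^ (2 * (a - 1))) * Literature.Analysis.FluidPDE.cknE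 r' (ν * T, x₀) (fun s y => fderiv ℝ (fun y => ν⁻¹ • u (s / ν) y) y)) (nhdsWithin 0 (Set.Ioi 0)) (nhds 0) → ∃ (r₁ : ℝ) (M : NNReal), 0 < r₁ ∧ ∀ r' ∈ Set.Ioc 0 r₁, ENNReal.ofReal (r' ^ (a - 1)) * Literature.Analysis.FluidPDE.cknE r' (ν * T, x₀) (fun s y => fderiv ℝ (fun y => ν⁻¹ • u (s / ν) y) y) ≤ (M : ENNReal)) :
    Summit.NavierStokesRegularity.NavierStokesRegularity.Theses.RootDecompStaticSkirt.ConicalSkirtFluxGauge := by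
  intro ν T hν hT u p hmax hLH hdec htend x₀ r a r₀ C J c η hs hj ha1 ha2 hr₀ hC hJ hc hη htemp hfloor
  obtain ⟨rC, MC, hrC, hCg⟩ :=
    hCC ν T hν hT u p hmax hLH hdec htend x₀ r a r₀ C J c η hs hj ha1 ha2 hr₀ hC hJ hc hη htemp hfloor
  obtain ⟨rE, ME, hrE, hEg⟩ :=
    hQL ν T hν hT u p hmax hLH hdec htend x₀ r a r₀ C J c η hs hj ha1 ha2 hr₀ hC hJ hc hη htemp hfloor
      (hNA ν T hν hT u p hmax hLH hdec htend x₀ r a r₀ C J c η hs hj ha1 ha2 hr₀ hC hJ hc hη htemp hfloor)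
  set vNu : ℝ → EuclideanSpace ℝ (Fin 3) → EuclideanSpace ℝ (Fin 3) := fun s y => ν⁻¹ • u (s / ν) y
    with hvNu_def
  set qNu : ℝ → EuclideanSpace ℝ (Fin 3) → ℝ := fun s y => (timeRescale ν⁻¹ (ν⁻¹ ^ 2) p) s y -
      ((timeRescale ν⁻¹ (ν⁻¹ ^ 2) p) s 0 - normalisedPressure (timeRescale ν⁻¹ ν⁻¹ u s) 0) with hqNu_def
  have hνT : 0 < ν * T := mul_pos hν hT
  set r₁ : ℝ := min (min rC rE) (Real.sqrt (ν * T)) with hr₁def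
  have hr₁ : 0 < r₁ := lt_min (lt_min hrC hrE) (Real.sqrt_pos.2 hνT)
  have hr₁C : r₁ ≤ rC := (min_le_left _ _).trans (min_le_left _ _)
  have hr₁E : r₁ ≤ rE := (min_le_left _ _).trans (min_le_right _ _)
  have hr₁T : r₁ ^ 2 ≤ ν * T := by
    have h1 : r₁ ≤ Real.sqrt (ν * T) := min_le_right _ _
    calc r₁ ^ 2 ≤ Real.sqrt (ν * T) ^ 2 := pow_le_pow_left₀ hr₁.le h1 2
      _ = ν * T := Real.sq_sqrt hνT.le
  -- the dissipation gauge makes the classical gradient square integrable on every small cylinder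
  have hEfin : ∀ r' ∈ Set.Ioc 0 r₁, ∫⁻ w in parabolicCylinder r' (ν * T, x₀),
      ENNReal.ofReal (frobeniusNormSq (fderiv ℝ (vNu w.1) w.2)) < ∞ := by
    intro r' hr'
    have h1 := hEg r' ⟨hr'.1, hr'.2.trans hr₁E⟩
    have hpos : ENNReal.ofReal (r' ^ (a - 1)) ≠ 0 :=
      (ENNReal.ofReal_pos.2 (Real.rpow_pos_of_pos hr'.1 _)).ne'
    have h2 : cknE r' (ν * T, x₀) (fun s y => fderiv ℝ (fun y => ν⁻¹ • u (s / ν) y) y) ≠ ∞ := by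
      intro htop
      rw [htop, ENNReal.mul_top hpos] at h1
      exact absurd h1 (by simp)
    rw [cknE] at h2
    have hr0 : (ENNReal.ofReal r')⁻¹ ≠ 0 := ENNReal.inv_ne_zero.2 ENNReal.ofReal_ne_top
    refine lt_top_iff_ne_top.2 fun hL => h2 ?_
    have hL' : ∫⁻ w in parabolicCylinder r' (ν * T, x₀),
        ENNReal.ofReal (frobeniusNormSq (fderiv ℝ (fun y => ν⁻¹ • u (w.1 / ν) y) w.2)) = ∞ := hL
    rw [hL', ENNReal.mul_top hr0]
  have hapex : ∀ r' ∈ Set.Ioc 0 r₁,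
      IsSuitableWeakSolutionInBall r' (ν * T, x₀) (vNu) (qNu) ∧
        HasWeakSpatialGradientOn (parabolicCylinderOpens r' (ν * T, x₀)) (vNu)
          (fun s y => fderiv ℝ (vNu s) y) := fun r' hr' =>
    apex_suitable hν hT hmax.1 hLH x₀ hr'.1 ((pow_le_pow_left₀ hr'.1.le hr'.2 2).trans hr₁T) (hEfin r' hr')
  -- the pressure gauge by K6 at radius r₁, exponent γ = 2(a − 1) ∈ (0, 1]
  have hγ : 0 < 2 * (a - 1) := by linarith
  have hγ1 : 2 * (a - 1) ≤ 1 := by linarith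
  obtain ⟨hIn₁, -⟩ := hapex r₁ ⟨hr₁, le_rfl⟩
  have hsol : IsDistributionalNSSolutionOn (parabolicCylinderOpens r₁ (ν * T, x₀)) 1 0 (vNu) (qNu) :=
    hIn₁.1.distributional
  have hD₁ : cknD r₁ (ν * T, x₀) (qNu) ≠ ∞ := cknD_ne_top_of_memLp hr₁ hIn₁.2.2.2
  obtain ⟨MD, hMD⟩ := pressureGauge_of_cubicGauge hr₁ hγ hγ1 hsol hD₁ (MC := MC)
    (fun r' hr' => hCg r' ⟨hr'.1, hr'.2.trans hr₁C⟩)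
  refine ⟨qNu, fun s y => fderiv ℝ (vNu s) y, r₁, ME + MD, hr₁, fun r' hr' => hapex r' hr',
    fun r' hr' => ?_⟩
  rw [ENNReal.coe_add]
  exact add_le_add (hEg r' ⟨hr'.1, hr'.2.trans hr₁E⟩) (hMD r' hr')

/-! ## The seam over the tree: LJᶜ 33319 ⟸ X_E 19832 ∧ CC ∧ NA ∧ QL -/

/-- **LJᶜ ⟸ X_E ∧ CC ∧ NA ∧ QL**: the landed engine kill (item 33329) fed with K8's flux gauge.  This is the body of the
child route's seam item `RootDecompOnsagerEdge.OnsagerSeam` with every hypothesis spelled as the items' signatures. -/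
theorem noTameConicalJoltingSkirt_of_onsager
    (hXE : EulerZoomLiouville.PowerGaugeEulerLiouville)
    (hCC : ∀ (ν T : ℝ), 0 < ν → 0 < T → ∀ (u : ℝ → EuclideanSpace ℝ (Fin 3) → EuclideanSpace ℝ (Fin 3)) (p : ℝ → EuclideanSpace ℝ (Fin 3) → ℝ), Literature.Analysis.FluidPDE.IsMaximalSmoothSolution ν 0 u p T → Literature.Analysis.FluidPDE.IsLerayHopfOn T ν 0 (u 0) u → Literature.Analysis.FluidPDE.HasRapidSpatialDecay (u 0) → Filter.Tendsto (fun t => MeasureTheory.eLpNorm (u t - u T) 2 MeasureTheory.volume) (nhdsWithin T (Set.Iio T)) (nhds 0) → ∀ (x₀ : EuclideanSpace ℝ (Fin 3)) (r : ℕ → ℝ) (a r₀ C J c η : ℝ), ((∀ k, 0 < r k) ∧ Filter.Tendsto r Filter.atTop (nhds 0) ∧ Filter.Tendsto (fun k => (r k)⁻¹ * ∫ x in Metric.ball x₀ (r k), ‖u T x‖ ^ 2) Filter.atTop Filter.atTop) → (∃ c : ℝ, 0 < c ∧ ∀ k, ∃ t ∈ Set.Ioo (T - r k ^ 2) T, c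 * (∫ x in Metric.ball x₀ (r k), ‖u T x‖ ^ 2) < ∫ x in Metric.ball x₀ (r k), ‖u t x - u T x‖ ^ 2) → 1 < a → a ≤ 3 / 2 → 0 < r₀ → 0 ≤ C → 0 ≤ J → 0 < c → 0 < η → (∀ ρ ∈ Set.Ioc 0 r₀, (∫⁻ x in Metric.ball x₀ ρ, ‖u T x‖ₑ ^ 2 ≤ ENNReal.ofReal (C * ρ ^ (3 - 2 * a))) ∧ ∀ s ∈ Set.Ioo (T - ρ ^ 2 / ν) T, ∫⁻ x in Metric.ball x₀ ρ, ‖u s x - u T x‖ₑ ^ 2 ≤ ENNReal.ofReal J * ∫⁻ x in Metric.ball x₀ ρ, ‖u T x‖ₑ ^ 2) → (∀ k : ℕ, ENNReal.ofReal (c * r k ^ (3 - 2 * a)) ≤ ∫⁻ x in Metric.ball x₀ (r k), ‖u T x‖ₑ ^ 2 ∧ ∀ s ∈ Set.Ioo (T - r k ^ (1 + a) / ν) T, ENNReal.ofReal η * ∫⁻ x in Metric.ball x₀ (r k), ‖u T x‖ₑ ^ 2 ≤ ∫⁻ x in Metric.ball x₀ (r k), ‖u s x‖ₑ ^ 2)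 → ∃ (r₁ : ℝ) (M : NNReal), 0 < r₁ ∧ ∀ r' ∈ Set.Ioc 0 r₁, ENNReal.ofReal (r' ^ (2 * (a - 1))) * Literature.Analysis.FluidPDE.cknC r' (ν * T, x₀) (fun s y => ν⁻¹ • u (s / ν) y) ≤ (M : ENNReal))
    (hNA : ∀ (ν T : ℝ), 0 < ν → 0 < T → ∀ (u : ℝ → EuclideanSpace ℝ (Fin 3) → EuclideanSpace ℝ (Fin 3)) (p : ℝ → EuclideanSpace ℝ (Fin 3) → ℝ), Literature.Analysis.FluidPDE.IsMaximalSmoothSolution ν 0 u p T → Literature.Analysis.FluidPDE.IsLerayHopfOn T ν 0 (u 0) u → Literature.Analysis.FluidPDE.HasRapidSpatialDecay (u 0) → Filter.Tendsto (fun t => MeasureTheory.eLpNorm (u t - u T) 2 MeasureTheory.volume) (nhdsWithin T (Set.Iio T)) (nhds 0) → ∀ (x₀ : EuclideanSpace ℝ (Fin 3)) (r : ℕ → ℝ) (a r₀ C J c η : ℝ), ((∀ k, 0 < r k) ∧ Filter.Tendsto r Filter.atTop (nhds 0) ∧ Filter.Tendsto (fun k => (r k)⁻¹ * ∫ x in Metric.ball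 x₀ (r k), ‖u T x‖ ^ 2) Filter.atTop Filter.atTop) → (∃ c : ℝ, 0 < c ∧ ∀ k, ∃ t ∈ Set.Ioo (T - r k ^ 2) T, c * (∫ x in Metric.ball x₀ (r k), ‖u T x‖ ^ 2) < ∫ x in Metric.ball x₀ (r k), ‖u t x - u T x‖ ^ 2) → 1 < a → a ≤ 3 / 2 → 0 < r₀ → 0 ≤ C → 0 ≤ J → 0 < c → 0 < η → (∀ ρ ∈ Set.Ioc 0 r₀, (∫⁻ x in Metric.ball x₀ ρ, ‖u T x‖ₑ ^ 2 ≤ ENNReal.ofReal (C * ρ ^ (3 - 2 * a))) ∧ ∀ s ∈ Set.Ioo (T - ρ ^ 2 / ν) T, ∫⁻ x in Metric.ball x₀ ρ, ‖u s x - u T x‖ₑ ^ 2 ≤ ENNReal.ofReal J * ∫⁻ x in Metric.ball x₀ ρ, ‖u T x‖ₑ ^ 2) → (∀ k : ℕ, ENNReal.ofReal (c * r k ^ (3 - 2 * a)) ≤ ∫⁻ x in Metric.ball x₀ (r k), ‖u T x‖ₑ ^ 2 ∧ ∀ s ∈ Set.Ioo (T - r k ^ (1 + a) / ν) T, ENNReal.ofReal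 η * ∫⁻ x in Metric.ball x₀ (r k), ‖u T x‖ₑ ^ 2 ≤ ∫⁻ x in Metric.ball x₀ (r k), ‖u s x‖ₑ ^ 2) → Filter.Tendsto (fun r' : ℝ => ENNReal.ofReal (r' ^ (2 * (a - 1))) * Literature.Analysis.FluidPDE.cknE r' (ν * T, x₀) (fun s y => fderiv ℝ (fun y => ν⁻¹ • u (s / ν) y) y)) (nhdsWithin 0 (Set.Ioi 0)) (nhds 0))
    (hQL : ∀ (ν T : ℝ), 0 < ν → 0 < T → ∀ (u : ℝ → EuclideanSpace ℝ (Fin 3) → EuclideanSpace ℝ (Fin 3)) (p : ℝ → EuclideanSpace ℝ (Fin 3) → ℝ), Literature.Analysis.FluidPDE.IsMaximalSmoothSolution ν 0 u p T → Literature.Analysis.FluidPDE.IsLerayHopfOn T ν 0 (u 0) u → Literature.Analysis.FluidPDE.HasRapidSpatialDecay (u 0) → Filter.Tendsto (fun t => MeasureTheory.eLpNorm (u t - u T) 2 MeasureTheory.volume) (nhdsWithin T (Set.Iio T)) (nhds 0) → ∀ (x₀ : EuclideanSpace ℝ (Fin 3)) (r : ℕ → ℝ) (a r₀ C J c η : ℝ),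 ((∀ k, 0 < r k) ∧ Filter.Tendsto r Filter.atTop (nhds 0) ∧ Filter.Tendsto (fun k => (r k)⁻¹ * ∫ x in Metric.ball x₀ (r k), ‖u T x‖ ^ 2) Filter.atTop Filter.atTop) → (∃ c : ℝ, 0 < c ∧ ∀ k, ∃ t ∈ Set.Ioo (T - r k ^ 2) T, c * (∫ x in Metric.ball x₀ (r k), ‖u T x‖ ^ 2) < ∫ x in Metric.ball x₀ (r k), ‖u t x - u T x‖ ^ 2) → 1 < a → a ≤ 3 / 2 → 0 < r₀ → 0 ≤ C → 0 ≤ J → 0 < c → 0 < η → (∀ ρ ∈ Set.Ioc 0 r₀, (∫⁻ x in Metric.ball x₀ ρ, ‖u T x‖ₑ ^ 2 ≤ ENNReal.ofReal (C * ρ ^ (3 - 2 * a))) ∧ ∀ s ∈ Set.Ioo (T - ρ ^ 2 / ν) T, ∫⁻ x in Metric.ball x₀ ρ, ‖u s x - u T x‖ₑ ^ 2 ≤ ENNReal.ofReal J * ∫⁻ x in Metric.ball x₀ ρ, ‖u T x‖ₑ ^ 2) → (∀ k : ℕ, ENNReal.ofReal (c * r k ^ (3 - 2 * a)) ≤ ∫⁻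 x in Metric.ball x₀ (r k), ‖u T x‖ₑ ^ 2 ∧ ∀ s ∈ Set.Ioo (T - r k ^ (1 + a) / ν) T, ENNReal.ofReal η * ∫⁻ x in Metric.ball x₀ (r k), ‖u T x‖ₑ ^ 2 ≤ ∫⁻ x in Metric.ball x₀ (r k), ‖u s x‖ₑ ^ 2) → Filter.Tendsto (fun r' : ℝ => ENNReal.ofReal (r' ^ (2 * (a - 1))) * Literature.Analysis.FluidPDE.cknE r' (ν * T, x₀) (fun s y => fderiv ℝ (fun y => ν⁻¹ • u (s / ν) y) y)) (nhdsWithin 0 (Set.Ioi 0)) (nhds 0) → ∃ (r₁ : ℝ) (M : NNReal), 0 < r₁ ∧ ∀ r' ∈ Set.Ioc 0 r₁, ENNReal.ofReal (r' ^ (a - 1)) * Literature.Analysis.FluidPDE.cknE r' (ν * T, x₀) (fun s y => fderiv ℝ (fun y => ν⁻¹ • u (s / ν) y) y) ≤ (M : ENNReal)) :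
    RootDecompStaticSkirt.NoTameConicalJoltingSkirt :=
  Summit.NavierStokesRegularity.NavierStokesRegularity.Theorems.RootDecompStaticSkirtEngineKill.rootDecompStaticSkirt_engineKillsConicalJolt_proof
    hXE (conicalSkirtFluxGauge_of_onsager hCC hNA hQL)

/-- With N25's landed cell glue: LJ 33217 `NoJoltingSupercriticalSkirt` ⟸ X_E ∧ CC ∧ NA ∧ QL ∧ LJʳ 33320. -/
theorem noJoltingSupercriticalSkirt_of_onsager
    (hXE : EulerZoomLiouville.PowerGaugeEulerLiouville)
    (hCC : ∀ (ν T : ℝ), 0 < ν → 0 < T → ∀ (u : ℝ → EuclideanSpace ℝ (Fin 3) → EuclideanSpace ℝ (Fin 3)) (p : ℝ → EuclideanSpace ℝ (Fin 3) → ℝ), Literature.Analysis.FluidPDE.IsMaximalSmoothSolution ν 0 u p T → Literature.Analysis.FluidPDE.IsLerayHopfOn T ν 0 (u 0) u → Literature.Analysis.FluidPDE.HasRapidSpatialDecay (u 0) → Filter.Tendsto (fun t => MeasureTheory.eLpNorm (u t - u T) 2 MeasureTheory.volume) (nhdsWithin T (Set.Iio T)) (nhds 0) → ∀ (x₀ :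 EuclideanSpace ℝ (Fin 3)) (r : ℕ → ℝ) (a r₀ C J c η : ℝ), ((∀ k, 0 < r k) ∧ Filter.Tendsto r Filter.atTop (nhds 0) ∧ Filter.Tendsto (fun k => (r k)⁻¹ * ∫ x in Metric.ball x₀ (r k), ‖u T x‖ ^ 2) Filter.atTop Filter.atTop) → (∃ c : ℝ, 0 < c ∧ ∀ k, ∃ t ∈ Set.Ioo (T - r k ^ 2) T, c * (∫ x in Metric.ball x₀ (r k), ‖u T x‖ ^ 2) < ∫ x in Metric.ball x₀ (r k), ‖u t x - u T x‖ ^ 2) → 1 < a → a ≤ 3 / 2 → 0 < r₀ → 0 ≤ C → 0 ≤ J → 0 < c → 0 < η → (∀ ρ ∈ Set.Ioc 0 r₀, (∫⁻ x in Metric.ball x₀ ρ, ‖u T x‖ₑ ^ 2 ≤ ENNReal.ofReal (C * ρ ^ (3 - 2 * a))) ∧ ∀ s ∈ Set.Ioo (T - ρ ^ 2 / ν) T, ∫⁻ x in Metric.ball x₀ ρ, ‖u s x - u T x‖ₑ ^ 2 ≤ ENNReal.ofReal J * ∫⁻ x in Metric.ball x₀ ρ, ‖u T x‖ₑ ^ 2)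 → (∀ k : ℕ, ENNReal.ofReal (c * r k ^ (3 - 2 * a)) ≤ ∫⁻ x in Metric.ball x₀ (r k), ‖u T x‖ₑ ^ 2 ∧ ∀ s ∈ Set.Ioo (T - r k ^ (1 + a) / ν) T, ENNReal.ofReal η * ∫⁻ x in Metric.ball x₀ (r k), ‖u T x‖ₑ ^ 2 ≤ ∫⁻ x in Metric.ball x₀ (r k), ‖u s x‖ₑ ^ 2) → ∃ (r₁ : ℝ) (M : NNReal), 0 < r₁ ∧ ∀ r' ∈ Set.Ioc 0 r₁, ENNReal.ofReal (r' ^ (2 * (a - 1))) * Literature.Analysis.FluidPDE.cknC r' (ν * T, x₀) (fun s y => ν⁻¹ • u (s / ν) y) ≤ (M : ENNReal))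
    (hNA : ∀ (ν T : ℝ), 0 < ν → 0 < T → ∀ (u : ℝ → EuclideanSpace ℝ (Fin 3) → EuclideanSpace ℝ (Fin 3)) (p : ℝ → EuclideanSpace ℝ (Fin 3) → ℝ), Literature.Analysis.FluidPDE.IsMaximalSmoothSolution ν 0 u p T → Literature.Analysis.FluidPDE.IsLerayHopfOn T ν 0 (u 0) u → Literature.Analysis.FluidPDE.HasRapidSpatialDecay (u 0) → Filter.Tendsto (fun t => MeasureTheory.eLpNorm (u t - u T) 2 MeasureTheory.volume) (nhdsWithin T (Set.Iio T)) (nhds 0) → ∀ (x₀ : EuclideanSpace ℝ (Fin 3)) (r : ℕ → ℝ) (a r₀ C J c η : ℝ), ((∀ k, 0 < r k) ∧ Filter.Tendsto r Filter.atTop (nhds 0) ∧ Filter.Tendsto (fun k => (r k)⁻¹ * ∫ x in Metric.ball x₀ (r k), ‖u T x‖ ^ 2) Filter.atTop Filter.atTop) → (∃ c : ℝ, 0 < c ∧ ∀ k, ∃ t ∈ Set.Ioo (T - r k ^ 2) T, c * (∫ x in Metric.ball x₀ (r k), ‖u T x‖ ^ 2) < ∫ x in Metric.ball x₀ (r k),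 ‖u t x - u T x‖ ^ 2) → 1 < a → a ≤ 3 / 2 → 0 < r₀ → 0 ≤ C → 0 ≤ J → 0 < c → 0 < η → (∀ ρ ∈ Set.Ioc 0 r₀, (∫⁻ x in Metric.ball x₀ ρ, ‖u T x‖ₑ ^ 2 ≤ ENNReal.ofReal (C * ρ ^ (3 - 2 * a))) ∧ ∀ s ∈ Set.Ioo (T - ρ ^ 2 / ν) T, ∫⁻ x in Metric.ball x₀ ρ, ‖u s x - u T x‖ₑ ^ 2 ≤ ENNReal.ofReal J * ∫⁻ x in Metric.ball x₀ ρ, ‖u T x‖ₑ ^ 2) → (∀ k : ℕ, ENNReal.ofReal (c * r k ^ (3 - 2 * a)) ≤ ∫⁻ x in Metric.ball x₀ (r k), ‖u T x‖ₑ ^ 2 ∧ ∀ s ∈ Set.Ioo (T - r k ^ (1 + a) / ν) T, ENNReal.ofReal η * ∫⁻ x in Metric.ball x₀ (r k), ‖u T x‖ₑ ^ 2 ≤ ∫⁻ x in Metric.ball x₀ (r k), ‖u s x‖ₑ ^ 2) → Filter.Tendsto (fun r' : ℝ => ENNReal.ofReal (r' ^ (2 * (a - 1))) * Literature.Analysis.FluidPDE.cknE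 r' (ν * T, x₀) (fun s y => fderiv ℝ (fun y => ν⁻¹ • u (s / ν) y) y)) (nhdsWithin 0 (Set.Ioi 0)) (nhds 0))
    (hQL : ∀ (ν T : ℝ), 0 < ν → 0 < T → ∀ (u : ℝ → EuclideanSpace ℝ (Fin 3) → EuclideanSpace ℝ (Fin 3)) (p : ℝ → EuclideanSpace ℝ (Fin 3) → ℝ), Literature.Analysis.FluidPDE.IsMaximalSmoothSolution ν 0 u p T → Literature.Analysis.FluidPDE.IsLerayHopfOn T ν 0 (u 0) u → Literature.Analysis.FluidPDE.HasRapidSpatialDecay (u 0) → Filter.Tendsto (fun t => MeasureTheory.eLpNorm (u t - u T) 2 MeasureTheory.volume) (nhdsWithin T (Set.Iio T)) (nhds 0) → ∀ (x₀ : EuclideanSpace ℝ (Fin 3)) (r : ℕ → ℝ) (a r₀ C J c η : ℝ), ((∀ k, 0 < r k) ∧ Filter.Tendsto r Filter.atTop (nhds 0) ∧ Filter.Tendsto (fun k => (r k)⁻¹ * ∫ x in Metric.ball x₀ (r k), ‖u T x‖ ^ 2) Filter.atTop Filter.atTop) → (∃ c : ℝ, 0 < c ∧ ∀ k, ∃ t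 ∈ Set.Ioo (T - r k ^ 2) T, c * (∫ x in Metric.ball x₀ (r k), ‖u T x‖ ^ 2) < ∫ x in Metric.ball x₀ (r k), ‖u t x - u T x‖ ^ 2) → 1 < a → a ≤ 3 / 2 → 0 < r₀ → 0 ≤ C → 0 ≤ J → 0 < c → 0 < η → (∀ ρ ∈ Set.Ioc 0 r₀, (∫⁻ x in Metric.ball x₀ ρ, ‖u T x‖ₑ ^ 2 ≤ ENNReal.ofReal (C * ρ ^ (3 - 2 * a))) ∧ ∀ s ∈ Set.Ioo (T - ρ ^ 2 / ν) T, ∫⁻ x in Metric.ball x₀ ρ, ‖u s x - u T x‖ₑ ^ 2 ≤ ENNReal.ofReal J * ∫⁻ x in Metric.ball x₀ ρ, ‖u T x‖ₑ ^ 2) → (∀ k : ℕ, ENNReal.ofReal (c * r k ^ (3 - 2 * a)) ≤ ∫⁻ x in Metric.ball x₀ (r k), ‖u T x‖ₑ ^ 2 ∧ ∀ s ∈ Set.Ioo (T - r k ^ (1 + a) / ν) T, ENNReal.ofReal η * ∫⁻ x in Metric.ball x₀ (r k), ‖u T x‖ₑ ^ 2 ≤ ∫⁻ x in Metric.ball x₀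 (r k), ‖u s x‖ₑ ^ 2) → Filter.Tendsto (fun r' : ℝ => ENNReal.ofReal (r' ^ (2 * (a - 1))) * Literature.Analysis.FluidPDE.cknE r' (ν * T, x₀) (fun s y => fderiv ℝ (fun y => ν⁻¹ • u (s / ν) y) y)) (nhdsWithin 0 (Set.Ioi 0)) (nhds 0) → ∃ (r₁ : ℝ) (M : NNReal), 0 < r₁ ∧ ∀ r' ∈ Set.Ioc 0 r₁, ENNReal.ofReal (r' ^ (a - 1)) * Literature.Analysis.FluidPDE.cknE r' (ν * T, x₀) (fun s y => fderiv ℝ (fun y => ν⁻¹ • u (s / ν) y) y) ≤ (M : ENNReal))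
    (hR : RootDecompStaticSkirt.NoRogueJoltingSkirt) : RootDecompStaticSkirt.NoJoltingSupercriticalSkirt :=
  Summit.NavierStokesRegularity.NavierStokesRegularity.Theorems.rootDecompStaticSkirt_noJoltingSupercriticalSkirt_of_cells_proof
    (noTameConicalJoltingSkirt_of_onsager hXE hCC hNA hQL) hR

/-- **Deciding composition at N25** (every binder consumed): Rest 33218 ∧ RS 33216 ∧ X_E ∧ CC ∧ NA ∧ QL ∧ LJʳ ⟹ Clay (A),
through N25's born `closes` BY NAME. -/
theorem closes_N25_onsager (hK : RootDecompStaticSkirt.LitSliceConeRest)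
    (hRS : RootDecompStaticSkirt.NoStaticSupercriticalSkirt)
    (hXE : EulerZoomLiouville.PowerGaugeEulerLiouville)
    (hCC : ∀ (ν T : ℝ), 0 < ν → 0 < T → ∀ (u : ℝ → EuclideanSpace ℝ (Fin 3) → EuclideanSpace ℝ (Fin 3)) (p : ℝ → EuclideanSpace ℝ (Fin 3) → ℝ), Literature.Analysis.FluidPDE.IsMaximalSmoothSolution ν 0 u p T → Literature.Analysis.FluidPDE.IsLerayHopfOn T ν 0 (u 0) u → Literature.Analysis.FluidPDE.HasRapidSpatialDecay (u 0) → Filter.Tendsto (fun t => MeasureTheory.eLpNorm (u t - u T) 2 MeasureTheory.volume) (nhdsWithin T (Set.Iio T)) (nhds 0) → ∀ (x₀ : EuclideanSpace ℝ (Fin 3)) (r : ℕ → ℝ) (a r₀ C J c η : ℝ), ((∀ k, 0 < r k) ∧ Filter.Tendsto r Filter.atTop (nhds 0) ∧ Filter.Tendsto (fun k => (r k)⁻¹ * ∫ x in Metric.ball x₀ (r k), ‖u T x‖ ^ 2) Filter.atTop Filter.atTop) → (∃ c : ℝ, 0 < c ∧ ∀ k, ∃ t ∈ Set.Ioo (T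 - r k ^ 2) T, c * (∫ x in Metric.ball x₀ (r k), ‖u T x‖ ^ 2) < ∫ x in Metric.ball x₀ (r k), ‖u t x - u T x‖ ^ 2) → 1 < a → a ≤ 3 / 2 → 0 < r₀ → 0 ≤ C → 0 ≤ J → 0 < c → 0 < η → (∀ ρ ∈ Set.Ioc 0 r₀, (∫⁻ x in Metric.ball x₀ ρ, ‖u T x‖ₑ ^ 2 ≤ ENNReal.ofReal (C * ρ ^ (3 - 2 * a))) ∧ ∀ s ∈ Set.Ioo (T - ρ ^ 2 / ν) T, ∫⁻ x in Metric.ball x₀ ρ, ‖u s x - u T x‖ₑ ^ 2 ≤ ENNReal.ofReal J * ∫⁻ x in Metric.ball x₀ ρ, ‖u T x‖ₑ ^ 2) → (∀ k : ℕ, ENNReal.ofReal (c * r k ^ (3 - 2 * a)) ≤ ∫⁻ x in Metric.ball x₀ (r k), ‖u T x‖ₑ ^ 2 ∧ ∀ s ∈ Set.Ioo (T - r k ^ (1 + a) / ν) T, ENNReal.ofReal η * ∫⁻ x in Metric.ball x₀ (r k), ‖u T x‖ₑ ^ 2 ≤ ∫⁻ x in Metric.ball x₀ (r k), ‖u s x‖ₑ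 ^ 2) → ∃ (r₁ : ℝ) (M : NNReal), 0 < r₁ ∧ ∀ r' ∈ Set.Ioc 0 r₁, ENNReal.ofReal (r' ^ (2 * (a - 1))) * Literature.Analysis.FluidPDE.cknC r' (ν * T, x₀) (fun s y => ν⁻¹ • u (s / ν) y) ≤ (M : ENNReal))
    (hNA : ∀ (ν T : ℝ), 0 < ν → 0 < T → ∀ (u : ℝ → EuclideanSpace ℝ (Fin 3) → EuclideanSpace ℝ (Fin 3)) (p : ℝ → EuclideanSpace ℝ (Fin 3) → ℝ), Literature.Analysis.FluidPDE.IsMaximalSmoothSolution ν 0 u p T → Literature.Analysis.FluidPDE.IsLerayHopfOn T ν 0 (u 0) u → Literature.Analysis.FluidPDE.HasRapidSpatialDecay (u 0) → Filter.Tendsto (fun t => MeasureTheory.eLpNorm (u t - u T) 2 MeasureTheory.volume) (nhdsWithin T (Set.Iio T)) (nhds 0) → ∀ (x₀ : EuclideanSpace ℝ (Fin 3)) (r : ℕ → ℝ) (a r₀ C J c η : ℝ), ((∀ k, 0 < r k) ∧ Filter.Tendsto r Filter.atTop (nhds 0) ∧ Filter.Tendsto (fun k => (r k)⁻¹ * ∫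 x in Metric.ball x₀ (r k), ‖u T x‖ ^ 2) Filter.atTop Filter.atTop) → (∃ c : ℝ, 0 < c ∧ ∀ k, ∃ t ∈ Set.Ioo (T - r k ^ 2) T, c * (∫ x in Metric.ball x₀ (r k), ‖u T x‖ ^ 2) < ∫ x in Metric.ball x₀ (r k), ‖u t x - u T x‖ ^ 2) → 1 < a → a ≤ 3 / 2 → 0 < r₀ → 0 ≤ C → 0 ≤ J → 0 < c → 0 < η → (∀ ρ ∈ Set.Ioc 0 r₀, (∫⁻ x in Metric.ball x₀ ρ, ‖u T x‖ₑ ^ 2 ≤ ENNReal.ofReal (C * ρ ^ (3 - 2 * a))) ∧ ∀ s ∈ Set.Ioo (T - ρ ^ 2 / ν) T, ∫⁻ x in Metric.ball x₀ ρ, ‖u s x - u T x‖ₑ ^ 2 ≤ ENNReal.ofReal J * ∫⁻ x in Metric.ball x₀ ρ, ‖u T x‖ₑ ^ 2) → (∀ k : ℕ, ENNReal.ofReal (c * r k ^ (3 - 2 * a)) ≤ ∫⁻ x in Metric.ball x₀ (r k), ‖u T x‖ₑ ^ 2 ∧ ∀ s ∈ Set.Ioo (T - r k ^ (1 + a) /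 ν) T, ENNReal.ofReal η * ∫⁻ x in Metric.ball x₀ (r k), ‖u T x‖ₑ ^ 2 ≤ ∫⁻ x in Metric.ball x₀ (r k), ‖u s x‖ₑ ^ 2) → Filter.Tendsto (fun r' : ℝ => ENNReal.ofReal (r' ^ (2 * (a - 1))) * Literature.Analysis.FluidPDE.cknE r' (ν * T, x₀) (fun s y => fderiv ℝ (fun y => ν⁻¹ • u (s / ν) y) y)) (nhdsWithin 0 (Set.Ioi 0)) (nhds 0))
    (hQL : ∀ (ν T : ℝ), 0 < ν → 0 < T → ∀ (u : ℝ → EuclideanSpace ℝ (Fin 3) → EuclideanSpace ℝ (Fin 3)) (p : ℝ → EuclideanSpace ℝ (Fin 3) → ℝ), Literature.Analysis.FluidPDE.IsMaximalSmoothSolution ν 0 u p T → Literature.Analysis.FluidPDE.IsLerayHopfOn T ν 0 (u 0) u → Literature.Analysis.FluidPDE.HasRapidSpatialDecay (u 0) → Filter.Tendsto (fun t => MeasureTheory.eLpNorm (u t - u T) 2 MeasureTheory.volume) (nhdsWithin T (Set.Iio T)) (nhds 0) → ∀ (x₀ : EuclideanSpace ℝ (Fin 3)) (r : ℕ → ℝ)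 (a r₀ C J c η : ℝ), ((∀ k, 0 < r k) ∧ Filter.Tendsto r Filter.atTop (nhds 0) ∧ Filter.Tendsto (fun k => (r k)⁻¹ * ∫ x in Metric.ball x₀ (r k), ‖u T x‖ ^ 2) Filter.atTop Filter.atTop) → (∃ c : ℝ, 0 < c ∧ ∀ k, ∃ t ∈ Set.Ioo (T - r k ^ 2) T, c * (∫ x in Metric.ball x₀ (r k), ‖u T x‖ ^ 2) < ∫ x in Metric.ball x₀ (r k), ‖u t x - u T x‖ ^ 2) → 1 < a → a ≤ 3 / 2 → 0 < r₀ → 0 ≤ C → 0 ≤ J → 0 < c → 0 < η → (∀ ρ ∈ Set.Ioc 0 r₀, (∫⁻ x in Metric.ball x₀ ρ, ‖u T x‖ₑ ^ 2 ≤ ENNReal.ofReal (C * ρ ^ (3 - 2 * a))) ∧ ∀ s ∈ Set.Ioo (T - ρ ^ 2 / ν) T, ∫⁻ x in Metric.ball x₀ ρ, ‖u s x - u T x‖ₑ ^ 2 ≤ ENNReal.ofReal J * ∫⁻ x in Metric.ball x₀ ρ, ‖u T x‖ₑ ^ 2) → (∀ k : ℕ, ENNReal.ofReal (c * r k ^ (3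 - 2 * a)) ≤ ∫⁻ x in Metric.ball x₀ (r k), ‖u T x‖ₑ ^ 2 ∧ ∀ s ∈ Set.Ioo (T - r k ^ (1 + a) / ν) T, ENNReal.ofReal η * ∫⁻ x in Metric.ball x₀ (r k), ‖u T x‖ₑ ^ 2 ≤ ∫⁻ x in Metric.ball x₀ (r k), ‖u s x‖ₑ ^ 2) → Filter.Tendsto (fun r' : ℝ => ENNReal.ofReal (r' ^ (2 * (a - 1))) * Literature.Analysis.FluidPDE.cknE r' (ν * T, x₀) (fun s y => fderiv ℝ (fun y => ν⁻¹ • u (s / ν) y) y)) (nhdsWithin 0 (Set.Ioi 0)) (nhds 0) → ∃ (r₁ : ℝ) (M : NNReal), 0 < r₁ ∧ ∀ r' ∈ Set.Ioc 0 r₁, ENNReal.ofReal (r' ^ (a - 1)) * Literature.Analysis.FluidPDE.cknE r' (ν * T, x₀) (fun s y => fderiv ℝ (fun y => ν⁻¹ • u (s / ν) y) y) ≤ (M : ENNReal))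
    (hR : RootDecompStaticSkirt.NoRogueJoltingSkirt) : _root_.NavierStokesRegularity :=
  RootDecompStaticSkirt.closes hK hRS (noJoltingSupercriticalSkirt_of_onsager hXE hCC hNA hQL hR)

end Summit.NavierStokesRegularity.NavierStokesRegularity.Theorems.RootDecompStaticSkirtOnsagerSeam

end
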